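import Summits.QuantumFields.BalabanUV.Beta.GAN24.SrecExitChargeLevelZero
import Summits.QuantumFields.BalabanUV.Beta.GAN24.KernelLegCharges

/-!
# `BalabanUV.Beta.GAN24.SrecExitChargeSucc` — binder row G-an2-4 ∕ (CONV-C), the (S) row of RULING R-gan24p1-g27-1 B (viii), the slot-charge tower of the pure S tables:
# **AT EVERY LEVEL `j+1` THE EXIT⊗EXIT SLOT-CHARGE FUNCTION OF THE STEP TABLE IS THE WILSON-WEIGHTED CUBIC PUSH ALONE** — the border table is off the ff block and the
# Λ-piece is exit⊗exit-free for every coefficient family (PART 2 §1), so `C^{exit}(SrecAt … (j+1)) = (cE·wE_{j+1})·C^{exit}(e3OfK Lc G_j (SrecAt … j))`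
# (G-an2-4 formalisation swarm → CRUX TEAM (2), leaf prover `b2b-balaban-gan24-formalise-leaf-02`, gen 56, PART 5 — the first line of the level-2 analysis)

NOT IN PRINT; OUR BOOKKEEPING ([folklore] linearity BY NAME over leaf-10's `WardLocusRecursive.SrecAt_succ`, an2's `ValueJetGeneric.locStencil_e3OfK` + `decays_coDressKBmAt_KInvStep` +
`locStencil_SrecAt`, leaf-06's `KernelLegCharges.summable_prod_of_biLoc`, my g47 `summable_mul_SLam_hessFFAt` and g56 PART 2 `exitFace_mul_tsum_exitFace_SLam_hessFFAt_eq_zero`;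
0 `def`, 0 cited fact, 0 `def … : Prop`, 0 sorry).  HONEST FRAMING (cell contract, verbatim): «discharging `BetaPertH` makes Bałaban's UV stability UNCONDITIONAL — a real
constructive-QFT result; it is NOT the continuum limit and NOT the Clay problem.»  HONEST DEPENDENCY (verbatim): «continuum YM on T⁴ ⇐ BetaPertH ∧ nine spine estimates (0/9
proved); BetaPertH ⇐ (D1) ∧ (D4) ∧ CAP+tail; G-an2-4 gates asym, D1 and NE2/3/4.»

* §1 `srecAt_succ_inl_inl` (the ff entries of member `j+1`: cubic push + Λ-piece; `vhSAt` off the block), `summable_exitFace_mul_e3OfK` (one exit leg of the push is summable —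
  `locStencil_e3OfK`), `tsum_exitFace_mul_srecAt_succ_inl_inl` (one exit leg, linearity).
* §2 **`tsum_exitFace_tsum_exitFace_srecAt_succ`**: `Σ'_z 𝟙^{exit}_β(z)·Σ'_x 𝟙^{exit}_α(x)·(SrecAt … (j+1) κ u) x z (inl α)(inl β)
  = (cE·wE d Lc (j+1)) · Σ'_z 𝟙^{exit}_β(z)·Σ'_x 𝟙^{exit}_α(x)·(e3OfK Lc G_j (SrecAt … j) κ u) x z (inl α)(inl β)` for every `j`, box root, slot, channel — with
  `e3OfK … x z (inl α)(inl β) = −(G_j ∘ vertexOfK G_j Lc (SrecAt j) κ u ∘ G_j)(Lc•x, Lc•z)(inr α)(inr β)` (an2's `e3OfK_apply`) this is the EXIT-WEIGHTED `mm`-sandwich the level-`(j+2)`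
  plain row reads (PART 3's reduction one level up; memo `HZETA-TOWER-v1.md` §3).
Asserts NO value of the push; NOTHING of (W-γ) ∕ (INV) ∕ (S) ∕ (Q-R) ∕ (LT) ∕ (Q-L) ∕ (C) ∕ «T2Shape» ∕ (hW, hWall) discharged; NEVER «G-an2-4 closed» as (CONV-C); NOT D1, NOT `BetaPertH`,
NOT continuum, NOT Clay.  2026-08-22; no existing file touched.
-/

noncomputable section

open Finset
open scoped BigOperators
open Literature.MathematicalPhysics.QuantumFieldTheory
open Literature.MathematicalPhysics.QuantumFieldTheory.Balaban1983to89
open Literature.MathematicalPhysics.QuantumFieldTheory.Balaban1983to89.Beta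
open ExpKernelCalculus (Site MKer)
open OneStepResolventKernel (Fib LocStencil)
open OneStepKernelFamily (KInvStep)
open AffineAveraging (box toSite)
open AveragingHessianKernelsRooted (vhSAt hessFFAt)
open InterLevelTransport (SLam)
open BalabanStepJetsSucc (wE wVH wΛ lamCoeffK E2)
open Summit.QuantumFields.BalabanUV.Beta.AxialDressingRooted (coDressKBmAt decays_coDressKBmAt_KInvStep)
open Summit.QuantumFields.BalabanUV.Beta.SpineRooted (e3OfK locStencil_e3OfK)
open Summit.QuantumFields.BalabanUV.Beta.WardLocusRecursive (SrecAt SrecAt_succ locStencil_SrecAt)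
open Summit.QuantumFields.BalabanUV.Beta.GAN24.KernelLegCharges (summable_prod_of_biLoc)
open Summit.QuantumFields.BalabanUV.Beta.GAN24.HessianGaugeLegContact (summable_mul_SLam_hessFFAt)
open Summit.QuantumFields.BalabanUV.Beta.GAN24.SrecExitChargeLevelZero (exitFace_mul_tsum_exitFace_SLam_hessFFAt_eq_zero)

namespace Summit.QuantumFields.BalabanUV.Beta.GAN24.SrecExitChargeSucc

variable {d : ℕ}

/-! ## §1 The ff entries of member `j+1` and one exit leg -/

/-- [folklore] **THE ff ENTRIES OF MEMBER `j+1`**: `SrecAt … (j+1) κ u x z (inl α)(inl β) = (cE·wE_{j+1})·e3OfK … x z (inl α)(inl β) + (cΛ·wΛ_{j+1})·SΛ_{j+1} κ u x z (inl α)(inl β)`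
(the rooted border `vhSAt` is off the ff block, `rfl`). -/
theorem srecAt_succ_inl_inl {Lc : ℕ} [NeZero Lc] (ρ : Fin (d + 1) → ℤ) (cE cVH cΛ : ℝ) (j : ℕ) (κ : Fin (d + 1)) (u x z : Site (d + 1)) (α β : Fin (d + 1)) :
    SrecAt d Lc ρ cE cVH cΛ (j + 1) κ u x z (Sum.inl α) (Sum.inl β)
      = (cE * wE d Lc (j + 1)) * e3OfK Lc (coDressKBmAt ρ Lc (KInvStep (d := d) Lc j)) (SrecAt d Lc ρ cE cVH cΛ j) κ u x z (Sum.inl α) (Sum.inl β)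
        + (cΛ * wΛ d Lc (j + 1)) *
          SLam Lc (lamCoeffK (KInvStep (d := d) Lc (j + 1)) (E2 d Lc (j + 1)) Lc) (fun μ y => hessFFAt ρ Lc μ y) κ u x z (Sum.inl α) (Sum.inl β) := by
  have h0 : vhSAt ρ d Lc rfl κ u x z (Sum.inl α) (Sum.inl β) = 0 := rfl
  rw [SrecAt_succ]
  simp only [Pi.add_apply, Pi.smul_apply, smul_eq_mul, h0, mul_zero, add_zero]

/-- [folklore] One exit leg of the cubic push is summable (an2's `locStencil_e3OfK`: the push of a local table through a decaying kernel is a local table). -/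
theorem summable_exitFace_mul_e3OfK {Lc : ℕ} [NeZero Lc] (hLc : 1 ≤ Lc) {r : Fin (d + 1) → ℕ} (hr : r ∈ box (d + 1) Lc) (cE cVH cΛ : ℝ) (j : ℕ)
    (κ : Fin (d + 1)) (u z : Site (d + 1)) (α β : Fin (d + 1)) :
    Summable fun x : Site (d + 1) => (if x α % (Lc : ℤ) = (Lc : ℤ) - 1 then (1 : ℝ) else 0) *
      e3OfK Lc (coDressKBmAt (toSite r) Lc (KInvStep (d := d) Lc j)) (SrecAt d Lc (toSite r) cE cVH cΛ j) κ u x z (Sum.inl α) (Sum.inl β) := by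
  obtain ⟨Cs, δs, hδs, hS⟩ := locStencil_SrecAt (d := d) (Lc := Lc) hLc hr cE cVH cΛ j
  obtain ⟨C, δ, hδ, hE⟩ := locStencil_e3OfK (N := Lc) hLc (decays_coDressKBmAt_KInvStep (d := d) hr j) hS hδs
  have hx : Summable fun x : Site (d + 1) =>
      e3OfK Lc (coDressKBmAt (toSite r) Lc (KInvStep (d := d) Lc j)) (SrecAt d Lc (toSite r) cE cVH cΛ j) κ u x z (Sum.inl α) (Sum.inl β) :=
    ((summable_prod_of_biLoc (hE κ u) hδ (Sum.inl α) (Sum.inl β)).prod_symm).prod_factor z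
  refine Summable.of_norm_bounded hx.abs (fun x => ?_)
  rw [Real.norm_eq_abs, abs_mul]
  have h1 : |(if x α % (Lc : ℤ) = (Lc : ℤ) - 1 then (1 : ℝ) else 0)| ≤ 1 := by split_ifs <;> simp
  calc _ ≤ 1 * |e3OfK Lc (coDressKBmAt (toSite r) Lc (KInvStep (d := d) Lc j)) (SrecAt d Lc (toSite r) cE cVH cΛ j) κ u x z (Sum.inl α) (Sum.inl β)| := by
          gcongr
    _ = _ := one_mul _

/-- NOT IN PRINT; OUR BOOKKEEPING.  **ONE EXIT LEG OF MEMBER `j+1`** (box root): `Σ'_x 𝟙^{exit}_α(x)·SrecAt (j+1) … = (cE·wE_{j+1})·(exit leg of the push) + (cΛ·wΛ_{j+1})·(exit leg of the Λ-piece)`. -/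
theorem tsum_exitFace_mul_srecAt_succ_inl_inl {Lc : ℕ} [NeZero Lc] (hLc : 1 ≤ Lc) {r : Fin (d + 1) → ℕ} (hr : r ∈ box (d + 1) Lc) (cE cVH cΛ : ℝ) (j : ℕ)
    (κ : Fin (d + 1)) (u z : Site (d + 1)) (α β : Fin (d + 1)) :
    ∑' x, (if x α % (Lc : ℤ) = (Lc : ℤ) - 1 then (1 : ℝ) else 0) * SrecAt d Lc (toSite r) cE cVH cΛ (j + 1) κ u x z (Sum.inl α) (Sum.inl β)
      = (cE * wE d Lc (j + 1)) * ∑' x, (if x α % (Lc : ℤ) = (Lc : ℤ) - 1 then (1 : ℝ) else 0) *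
            e3OfK Lc (coDressKBmAt (toSite r) Lc (KInvStep (d := d) Lc j)) (SrecAt d Lc (toSite r) cE cVH cΛ j) κ u x z (Sum.inl α) (Sum.inl β)
        + (cΛ * wΛ d Lc (j + 1)) * ∑' x, (if x α % (Lc : ℤ) = (Lc : ℤ) - 1 then (1 : ℝ) else 0) *
            SLam Lc (lamCoeffK (KInvStep (d := d) Lc (j + 1)) (E2 d Lc (j + 1)) Lc) (fun μ y => hessFFAt (toSite r) Lc μ y) κ u x z (Sum.inl α) (Sum.inl β) := by
  have h1 := summable_exitFace_mul_e3OfK hLc hr cE cVH cΛ j κ u z α β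
  have h2 := summable_mul_SLam_hessFFAt (N := Lc) hLc hr (lamCoeffK (KInvStep (d := d) Lc (j + 1)) (E2 d Lc (j + 1)) Lc) κ u z α β
    (fun x => (if x α % (Lc : ℤ) = (Lc : ℤ) - 1 then (1 : ℝ) else 0))
  simp only [srecAt_succ_inl_inl]
  have e : ∀ x, (if x α % (Lc : ℤ) = (Lc : ℤ) - 1 then (1 : ℝ) else 0) *
        ((cE * wE d Lc (j + 1)) * e3OfK Lc (coDressKBmAt (toSite r) Lc (KInvStep (d := d) Lc j)) (SrecAt d Lc (toSite r) cE cVH cΛ j) κ u x z (Sum.inl α) (Sum.inl β)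
          + (cΛ * wΛ d Lc (j + 1)) *
            SLam Lc (lamCoeffK (KInvStep (d := d) Lc (j + 1)) (E2 d Lc (j + 1)) Lc) (fun μ y => hessFFAt (toSite r) Lc μ y) κ u x z (Sum.inl α) (Sum.inl β))
      = (cE * wE d Lc (j + 1)) * ((if x α % (Lc : ℤ) = (Lc : ℤ) - 1 then (1 : ℝ) else 0) *
            e3OfK Lc (coDressKBmAt (toSite r) Lc (KInvStep (d := d) Lc j)) (SrecAt d Lc (toSite r) cE cVH cΛ j) κ u x z (Sum.inl α) (Sum.inl β))
        + (cΛ * wΛ d Lc (j + 1)) * ((if x α % (Lc : ℤ) = (Lc : ℤ) - 1 then (1 : ℝ) else 0) *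
            SLam Lc (lamCoeffK (KInvStep (d := d) Lc (j + 1)) (E2 d Lc (j + 1)) Lc) (fun μ y => hessFFAt (toSite r) Lc μ y) κ u x z (Sum.inl α) (Sum.inl β)) :=
    fun x => by ring
  rw [tsum_congr e, Summable.tsum_add (h1.mul_left _) (h2.mul_left _), tsum_mul_left, tsum_mul_left]

/-! ## §2 The exit⊗exit slot-charge function of member `j+1` is the Wilson-weighted push -/

/-- NOT IN PRINT; OUR BOOKKEEPING.  **AT EVERY LEVEL THE EXIT⊗EXIT SLOT CHARGE OF THE STEP TABLE IS THE CUBIC PUSH'S, TIMES `cE·wE_{j+1}`** (box root `ρ = toSite r`, every `j`, every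
`cE cVH cΛ`, slot `(κ,u)`, ff channel `(α,β)`):
`Σ'_z 𝟙^{exit}_β(z)·Σ'_x 𝟙^{exit}_α(x)·(SrecAt d Lc ρ cE cVH cΛ (j+1) κ u) x z (inl α)(inl β) = (cE·wE d Lc (j+1))·Σ'_z 𝟙^{exit}_β(z)·Σ'_x 𝟙^{exit}_α(x)·(e3OfK Lc G_j (SrecAt … j) κ u) x z (inl α)(inl β)`
— the Λ-piece of member `j+1` is exit⊗exit-free (PART 2 §1 at `c = lamCoeffK (KInvStep Lc (j+1)) (E2 (j+1)) Lc`, `N = Lc`) and the border is off the block. -/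
theorem tsum_exitFace_tsum_exitFace_srecAt_succ {Lc : ℕ} [NeZero Lc] (hLc : 1 ≤ Lc) {r : Fin (d + 1) → ℕ} (hr : r ∈ box (d + 1) Lc) (cE cVH cΛ : ℝ) (j : ℕ)
    (κ : Fin (d + 1)) (u : Site (d + 1)) (α β : Fin (d + 1)) :
    ∑' z, (if z β % (Lc : ℤ) = (Lc : ℤ) - 1 then (1 : ℝ) else 0) *
        ∑' x, (if x α % (Lc : ℤ) = (Lc : ℤ) - 1 then (1 : ℝ) else 0) * SrecAt d Lc (toSite r) cE cVH cΛ (j + 1) κ u x z (Sum.inl α) (Sum.inl β)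
      = (cE * wE d Lc (j + 1)) * ∑' z, (if z β % (Lc : ℤ) = (Lc : ℤ) - 1 then (1 : ℝ) else 0) *
          ∑' x, (if x α % (Lc : ℤ) = (Lc : ℤ) - 1 then (1 : ℝ) else 0) *
            e3OfK Lc (coDressKBmAt (toSite r) Lc (KInvStep (d := d) Lc j)) (SrecAt d Lc (toSite r) cE cVH cΛ j) κ u x z (Sum.inl α) (Sum.inl β) := by
  rw [← tsum_mul_left]
  refine tsum_congr fun z => ?_
  rw [tsum_exitFace_mul_srecAt_succ_inl_inl hLc hr, mul_add, ← mul_assoc _ (cΛ * wΛ d Lc (j + 1)), mul_comm _ (cΛ * wΛ d Lc (j + 1)), mul_assoc (cΛ * wΛ d Lc (j + 1)),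
    exitFace_mul_tsum_exitFace_SLam_hessFFAt_eq_zero hLc hr, mul_zero, add_zero]
  ring

end Summit.QuantumFields.BalabanUV.Beta.GAN24.SrecExitChargeSucc

end
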